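/-
Copyright: the b2b-balaban T⁴-continuum CRUX team, row NE7b leaf lineage `t4-ne7b-formalise-leaf-03` (gen 147). Project licence.
-/
import Summits.QuantumFields.BalabanUV.T4Continuum.Spine.NE7b.ConstrainedMinimiserRegularNonlinear
import Mathlib.Analysis.Analytic.Inverse
import Mathlib.Analysis.Analytic.Linear
import Mathlib.Analysis.Calculus.FDeriv.Analytic

/-!
# THE HARD STEP PRESERVES ANALYTICITY — NONLINEAR CONSTRAINT: for ANALYTIC `V`, `G` the KKT branch `w ↦ (δ(w), λ(w))`
# through a non-degenerate KKT pair is ANALYTIC (Mathlib's analytic inverse function theorem on the Lagrange map of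
# `ConstrainedMinimiserRegularNonlinear`), the value along it is analytic, and — where the branch minimises on the nonlinear
# fibres — so is the value function `φ w = ⨅ {V δ : G δ = w}`: print's «U_k(V) … is an analytic function of B = (1∕i) log V′»
# ([B11] CMP 102 Sect. G p.305) in the tree's abstract currency (row NE7b, node U5c; TRANSFER rows (ix)∕(xxiv), idea-1 T-93
# (b): on the SU(2) road «Lipschitz in the kept variable ↦ ANALYTIC in B after a gauge is fixed»; [folklore])

Cell `pub-balaban`, sub-cell `t4`, spine estimate NE7b (`T4WeightBudget.RelWeightBound`; NOT PRINTED in [Bałaban 1983–89],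
NOT PROVED).  Crux-route work under `Spine/NE7b/` by leaf-03 (CRUX team (2), FREEZE (0) crux-prover clause).  NOTHING of
Bałaban's is named, asserted, valued or discharged.  Imports this lineage's `ConstrainedMinimiserRegularNonlinear` (CMRN) +
Mathlib; no `def`; zero `sorry`.

WHY.  CMRN types the `Cⁿ` KKT branch and the `C^{n+1}` value for a NONLINEAR constraint (the SU(2) averaging is nonlinear:
`Q_k(U₀, ηA) = Q_k(U₀)A + C_k(U₀, A)`, [B8] (134)); `ConstrainedMinimiserAnalytic` (CMRA) upgrades the LINEAR case to
analyticity.  Print's statement for the gauge road is the analytic one (T-93: [B11] p.296 «the analyticity follows from …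
successive approximations», p.305 «analytic function of B … power series in B», (182)–(190) the first derivative with the
propagator's bounds).  This file is the nonlinear analytic twin: the Lagrange map `(δ, λ) ↦ (G δ, DV(δ) − λ ∘ DG(δ))` is
analytic when `V`, `G` are (`AnalyticAt.fderiv`, the bilinear `compL`), its derivative at `(δ₀, λ₀)` is CMRN §1's isomorphism,
and `OpenPartialHomeomorph.hasFPowerSeriesAt_symm` makes the local inverse — hence the branch — analytic.

WHAT IS PROVED ([folklore]; analytic implicit function theorem, Dieudonné (10.2.4); Fiacco 1983 Thm 2.1, analytic remark):
* §1 **`exists_analyticAt_kktBranch`** — `E`, `F` finite-dimensional; `V`, `G` ANALYTIC at `δ₀`; `DG(δ₀)` onto; KKT at `δ₀`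
  with `λ₀`; Lagrangian Hessian `D²V(δ₀) − λ₀ ∘ D²G(δ₀)` non-degenerate on `ker DG(δ₀)` ⟹ `∃ δ Λ`, `δ(Gδ₀) = δ₀`, `Λ(Gδ₀) = λ₀`,
  BOTH `AnalyticAt ℝ · (Gδ₀)`, EVENTUALLY `G(δ w) = w ∧ DV(δ w) = Λ w ∘ DG(δ w)`, and local uniqueness of KKT pairs.
* §2 `analyticAt_comp_kktBranch` (`V ∘ δ` analytic at `Gδ₀`); **`analyticAt_constrValueG_of_kkt`** — with the DISPLAYED
  identification «every ANALYTIC branch with §1's letters minimises on the fibres near `Gδ₀`» (CVL §2's supplier):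
  `AnalyticAt ℝ (fun w => ⨅ δ′ : {δ′ // G δ′ = w}, V δ′) (Gδ₀)`.
* §3 toy (`example`): `G = id` on `ℝ`.

NOT HERE (honest): the minimising identification (displayed); the linear case (CMRA); complex extensions ∕ radii (ATD
family); gauge ORBITS — the statement is on a gauge-fixed slice `E` (T-93 N-93-3, T-85 #28); infinite dimension; which
`V, G` are Bałaban's ((A3) ∕ (A1c), NC-NE7b-α UNRULED).  BY-NAME EFFECT ON THE WALL: NONE.  NE7b NOT PRINTED ∕ NOT PROVED;
spine PROVED 0∕9; rung (B)+1 on a FINITE torus — NOT infinite volume, NOT the mass gap, NOT Clay.  HONEST DEPENDENCY: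
continuum YM on T⁴ ⇐ BetaPertH ∧ nine spine estimates (0/9 proved); BetaPertH ⇐ (D1) ∧ (D4) ∧ CAP+tail; G-an2-4 gates asym,
D1 and NE2∕3∕4.
-/

set_option autoImplicit false

noncomputable section

namespace Summit.QuantumFields.BalabanUV.T4Continuum.NE7b.ConstrainedMinimiserAnalyticNonlinear

open Set Filter Topology Function
open Summit.QuantumFields.BalabanUV.T4Continuum.NE7b.ConstrainedMinimiserRegularNonlinear

variable {E F : Type*} [NormedAddCommGroup E] [NormedSpace ℝ E] [NormedAddCommGroup F] [NormedSpace ℝ F]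

/-! ## §1. The analytic branch of KKT pairs -/

section Branch

variable [FiniteDimensional ℝ E] [FiniteDimensional ℝ F]

/-- **THE ANALYTIC BRANCH OF KKT PAIRS.**  `E`, `F` finite-dimensional; `V : E → ℝ`, `G : E → F` ANALYTIC at `δ₀`; `DG(δ₀)`
onto; KKT at `δ₀` with multiplier `λ₀`; the Lagrangian Hessian non-degenerate on `ker DG(δ₀)`.  Then there are `δ : F → E`,
`Λ : F → (F →L ℝ)` with `δ (Gδ₀) = δ₀`, `Λ (Gδ₀) = λ₀`, both ANALYTIC at `Gδ₀`, EVENTUALLY `G (δ w) = w ∧ DV(δ w) = Λ w ∘ DG(δ w)`,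
and EVENTUALLY in `p → (δ₀, λ₀)`: KKT pairs lie on the branch. [folklore] -/
theorem exists_analyticAt_kktBranch {V : E → ℝ} {G : E → F} {δ₀ : E} {Λ₀ : F →L[ℝ] ℝ}
    (hV : AnalyticAt ℝ V δ₀) (hG : AnalyticAt ℝ G δ₀) (hT : Surjective (fderiv ℝ G δ₀))
    (hkkt : fderiv ℝ V δ₀ = Λ₀.comp (fderiv ℝ G δ₀))
    (hnd : ∀ k ∈ (fderiv ℝ G δ₀).ker, (∀ k' ∈ (fderiv ℝ G δ₀).ker,
      fderiv ℝ (fderiv ℝ V) δ₀ k k' - Λ₀ (fderiv ℝ (fderiv ℝ G) δ₀ k k') = 0) → k = 0) :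
    ∃ (δ : F → E) (Λ : F → (F →L[ℝ] ℝ)), δ (G δ₀) = δ₀ ∧ Λ (G δ₀) = Λ₀ ∧
      AnalyticAt ℝ δ (G δ₀) ∧ AnalyticAt ℝ Λ (G δ₀) ∧
      (∀ᶠ w in 𝓝 (G δ₀), G (δ w) = w ∧ fderiv ℝ V (δ w) = (Λ w).comp (fderiv ℝ G (δ w))) ∧
      (∀ᶠ p in 𝓝 (δ₀, Λ₀), fderiv ℝ V p.1 = p.2.comp (fderiv ℝ G p.1) → (δ (G p.1), Λ (G p.1)) = p) := by
  haveI : CompleteSpace (E × (F →L[ℝ] ℝ)) := FiniteDimensional.complete ℝ _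
  haveI : CompleteSpace (F × (E →L[ℝ] ℝ)) := FiniteDimensional.complete ℝ _
  -- the Lagrange map (CMRN §2) and its analyticity
  set Φ : E × (F →L[ℝ] ℝ) → F × (E →L[ℝ] ℝ) :=
    fun p => (G p.1, fderiv ℝ V p.1 - p.2.comp (fderiv ℝ G p.1)) with hΦ
  set T := fderiv ℝ G δ₀ with hTdef
  set V'' := fderiv ℝ (fderiv ℝ V) δ₀ with hV''
  set G'' := fderiv ℝ (fderiv ℝ G) δ₀ with hG''
  set pfst := ContinuousLinearMap.fst ℝ E (F →L[ℝ] ℝ) with hpfst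
  set psnd := ContinuousLinearMap.snd ℝ E (F →L[ℝ] ℝ) with hpsnd
  set Φ' := (T.comp pfst).prod (V''.comp pfst
      - (((ContinuousLinearMap.compL ℝ E F ℝ) Λ₀).comp (G''.comp pfst)
          + ((ContinuousLinearMap.compL ℝ E F ℝ).flip T).comp psnd)) with hΦ'
  have hΦp₀ : Φ (δ₀, Λ₀) = (G δ₀, 0) := by
    simp only [hΦ, hkkt, hTdef, sub_self]
  have hkkt_iff : ∀ p : E × (F →L[ℝ] ℝ), Φ p = (G p.1, 0) ↔ fderiv ℝ V p.1 = p.2.comp (fderiv ℝ G p.1) := fun p => by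
    simp only [hΦ, Prod.mk.injEq, true_and, sub_eq_zero]
  have hdVan : AnalyticAt ℝ (fderiv ℝ V) δ₀ := hV.fderiv
  have hdGan : AnalyticAt ℝ (fderiv ℝ G) δ₀ := hG.fderiv
  have hfst : AnalyticAt ℝ (fun p : E × (F →L[ℝ] ℝ) => p.1) (δ₀, Λ₀) := analyticAt_fst
  have hsnd : AnalyticAt ℝ (fun p : E × (F →L[ℝ] ℝ) => p.2) (δ₀, Λ₀) := analyticAt_snd
  have hGfst : AnalyticAt ℝ (fun p : E × (F →L[ℝ] ℝ) => G p.1) (δ₀, Λ₀) := AnalyticAt.comp (g := G) hG hfst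
  have hVfst : AnalyticAt ℝ (fun p : E × (F →L[ℝ] ℝ) => fderiv ℝ V p.1) (δ₀, Λ₀) :=
    AnalyticAt.comp (g := fderiv ℝ V) hdVan hfst
  have hGGfst : AnalyticAt ℝ (fun p : E × (F →L[ℝ] ℝ) => fderiv ℝ G p.1) (δ₀, Λ₀) :=
    AnalyticAt.comp (g := fderiv ℝ G) hdGan hfst
  have hcomp : AnalyticAt ℝ (fun p : E × (F →L[ℝ] ℝ) => p.2.comp (fderiv ℝ G p.1)) (δ₀, Λ₀) := by
    have hB := ((ContinuousLinearMap.compL ℝ E F ℝ).analyticAt_bilinear (Λ₀, fderiv ℝ G δ₀)).comp₂ hsnd hGGfst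
    exact hB.congr (Eventually.of_forall fun p => by simp [ContinuousLinearMap.compL_apply])
  have hΦan : AnalyticAt ℝ Φ (δ₀, Λ₀) := hGfst.prod (hVfst.sub hcomp)
  -- the derivative of Φ at (δ₀, Λ₀) (as in CMRN §2)
  have hGd : HasFDerivAt G T δ₀ := hG.differentiableAt.hasFDerivAt
  have hdVd : HasFDerivAt (fderiv ℝ V) V'' δ₀ := hdVan.differentiableAt.hasFDerivAt
  have hdGd : HasFDerivAt (fderiv ℝ G) G'' δ₀ := hdGan.differentiableAt.hasFDerivAt
  have hfstd : HasFDerivAt (fun p : E × (F →L[ℝ] ℝ) => p.1) pfst (δ₀, Λ₀) := hasFDerivAt_fst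
  have hsndd : HasFDerivAt (fun p : E × (F →L[ℝ] ℝ) => p.2) psnd (δ₀, Λ₀) := hasFDerivAt_snd
  have hΦd : HasFDerivAt Φ Φ' (δ₀, Λ₀) := by
    have h1 : HasFDerivAt (fun p : E × (F →L[ℝ] ℝ) => G p.1) (T.comp pfst) (δ₀, Λ₀) := hGd.comp (δ₀, Λ₀) hfstd
    have h2 : HasFDerivAt (fun p : E × (F →L[ℝ] ℝ) => fderiv ℝ V p.1) (V''.comp pfst) (δ₀, Λ₀) :=
      hdVd.comp (δ₀, Λ₀) hfstd
    have h3 : HasFDerivAt (fun p : E × (F →L[ℝ] ℝ) => fderiv ℝ G p.1) (G''.comp pfst) (δ₀, Λ₀) :=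
      hdGd.comp (δ₀, Λ₀) hfstd
    have h4 := hsndd.clm_comp h3
    exact h1.prodMk (h2.sub h4)
  -- the derivative is an isomorphism (CMRN §1, by name)
  have hinj : Φ'.ker = ⊥ := ker_lagrangeDeriv_eq_bot T hT V'' G'' Λ₀ hnd
  have hsurj : Φ'.range = ⊤ :=
    LinearMap.range_eq_top.mpr
      ((LinearMap.injective_iff_surjective_of_finrank_eq_finrank finrank_prod_dual_comm).mp
        (LinearMap.ker_eq_bot.mp hinj))
  set Φe := ContinuousLinearEquiv.ofBijective Φ' hinj hsurj with hΦe
  have hfd : fderiv ℝ Φ (δ₀, Λ₀) = (Φe : E × (F →L[ℝ] ℝ) →L[ℝ] F × (E →L[ℝ] ℝ)) := by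
    rw [hΦd.fderiv, hΦe, ContinuousLinearEquiv.coe_ofBijective]
  have hstrict : HasStrictFDerivAt Φ (Φe : E × (F →L[ℝ] ℝ) →L[ℝ] F × (E →L[ℝ] ℝ)) (δ₀, Λ₀) := by
    rw [← hfd]; exact hΦan.hasStrictFDerivAt
  -- the analytic inverse function theorem
  set P := hstrict.toOpenPartialHomeomorph Φ with hP
  have hsrc : (δ₀, Λ₀) ∈ P.source := hstrict.mem_toOpenPartialHomeomorph_source
  obtain ⟨p, hp⟩ := hΦan
  have hp1 : p 1 = (continuousMultilinearCurryFin1 ℝ (E × (F →L[ℝ] ℝ)) (F × (E →L[ℝ] ℝ))).symm Φe := by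
    have h := hp.fderiv_eq
    rw [hfd] at h
    rw [h]
    exact ((continuousMultilinearCurryFin1 ℝ (E × (F →L[ℝ] ℝ)) (F × (E →L[ℝ] ℝ))).symm_apply_apply (p 1)).symm
  have hPser : HasFPowerSeriesAt (P.symm) (p.leftInv Φe (δ₀, Λ₀)) (Φ (δ₀, Λ₀)) := P.hasFPowerSeriesAt_symm hsrc hp hp1
  set Ψ : F × (E →L[ℝ] ℝ) → E × (F →L[ℝ] ℝ) := hstrict.localInverse Φ _ (δ₀, Λ₀) with hΨ
  have hΨP : Ψ = P.symm := rfl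
  have hΨan : AnalyticAt ℝ Ψ (Φ (δ₀, Λ₀)) := by rw [hΨP]; exact hPser.analyticAt
  have hΨ0 : Ψ (Φ (δ₀, Λ₀)) = (δ₀, Λ₀) := hstrict.localInverse_apply_image
  have hleft : ∀ᶠ q in 𝓝 (δ₀, Λ₀), Ψ (Φ q) = q := hstrict.eventually_left_inverse
  have hright : ∀ᶠ y in 𝓝 (Φ (δ₀, Λ₀)), Φ (Ψ y) = y := hstrict.eventually_right_inverse
  -- the branch
  have hj : Continuous fun w : F => ((w, (0 : E →L[ℝ] ℝ)) : F × (E →L[ℝ] ℝ)) := continuous_id.prodMk continuous_const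
  have hjan : AnalyticAt ℝ (fun w : F => ((w, (0 : E →L[ℝ] ℝ)) : F × (E →L[ℝ] ℝ))) (G δ₀) :=
    (ContinuousLinearMap.inl ℝ F (E →L[ℝ] ℝ)).analyticAt (G δ₀) |>.congr (Eventually.of_forall fun w => by simp)
  have hΨan' : AnalyticAt ℝ (fun w : F => Ψ (w, 0)) (G δ₀) := by
    have h1 : AnalyticAt ℝ Ψ (G δ₀, (0 : E →L[ℝ] ℝ)) := by rw [← hΦp₀]; exact hΨan
    exact AnalyticAt.comp (g := Ψ) (f := fun w : F => ((w, (0 : E →L[ℝ] ℝ)) : F × (E →L[ℝ] ℝ))) h1 hjan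
  refine ⟨fun w => (Ψ (w, 0)).1, fun w => (Ψ (w, 0)).2, ?_, ?_, ?_, ?_, ?_, ?_⟩
  · show (Ψ (G δ₀, 0)).1 = δ₀
    rw [← hΦp₀, hΨ0]
  · show (Ψ (G δ₀, 0)).2 = Λ₀
    rw [← hΦp₀, hΨ0]
  · exact AnalyticAt.comp (g := fun q : E × (F →L[ℝ] ℝ) => q.1) analyticAt_fst hΨan'
  · exact AnalyticAt.comp (g := fun q : E × (F →L[ℝ] ℝ) => q.2) analyticAt_snd hΨan'
  · have ht : Tendsto (fun w : F => ((w, (0 : E →L[ℝ] ℝ)) : F × (E →L[ℝ] ℝ))) (𝓝 (G δ₀)) (𝓝 (Φ (δ₀, Λ₀))) := by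
      rw [hΦp₀]; exact hj.continuousAt
    filter_upwards [ht.eventually hright] with w hw
    have h1 : G (Ψ (w, 0)).1 = w := congrArg Prod.fst hw
    refine ⟨h1, (hkkt_iff (Ψ (w, 0))).mp ?_⟩
    rw [hw, h1]
  · filter_upwards [hleft] with q hq hk
    have : Φ q = (G q.1, 0) := (hkkt_iff q).mpr hk
    rw [← this, hq]

end Branch

/-! ## §2. The value along the branch and the value function are analytic -/

/-- `V ∘ δ` is analytic at `w₀` when `V` is analytic at `δ w₀` and `δ` at `w₀`. [folklore] -/
theorem analyticAt_comp_kktBranch {V : E → ℝ} {δ : F → E} {w₀ : F} (hV : AnalyticAt ℝ V (δ w₀))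
    (hδ : AnalyticAt ℝ δ w₀) : AnalyticAt ℝ (V ∘ δ) w₀ :=
  hV.comp hδ

/-- **THE VALUE FUNCTION ON THE NONLINEAR FIBRES IS ANALYTIC** (finite dimension; `V`, `G` analytic at `δ₀`; `DG(δ₀)` onto;
KKT at `δ₀`; Lagrangian Hessian non-degenerate on `ker DG(δ₀)`; and the DISPLAYED identification that every ANALYTIC branch
`(δ, Λ)` with §1's letters — base point `(δ₀, λ₀)`, EVENTUALLY `G(δ w) = w ∧ DV(δ w) = Λ w ∘ DG(δ w)` — minimises on the fibres
near `Gδ₀`): `AnalyticAt ℝ (fun w => ⨅ δ′ : {δ′ // G δ′ = w}, V δ′) (Gδ₀)`. [folklore] -/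
theorem analyticAt_constrValueG_of_kkt [FiniteDimensional ℝ E] [FiniteDimensional ℝ F] {V : E → ℝ} {G : E → F} {δ₀ : E}
    {Λ₀ : F →L[ℝ] ℝ} (hV : AnalyticAt ℝ V δ₀) (hG : AnalyticAt ℝ G δ₀) (hT : Surjective (fderiv ℝ G δ₀))
    (hkkt : fderiv ℝ V δ₀ = Λ₀.comp (fderiv ℝ G δ₀))
    (hnd : ∀ k ∈ (fderiv ℝ G δ₀).ker, (∀ k' ∈ (fderiv ℝ G δ₀).ker,
      fderiv ℝ (fderiv ℝ V) δ₀ k k' - Λ₀ (fderiv ℝ (fderiv ℝ G) δ₀ k k') = 0) → k = 0)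
    (hmin : ∀ (δ : F → E) (Λ : F → (F →L[ℝ] ℝ)), δ (G δ₀) = δ₀ → Λ (G δ₀) = Λ₀ →
      AnalyticAt ℝ δ (G δ₀) → AnalyticAt ℝ Λ (G δ₀) →
      (∀ᶠ w in 𝓝 (G δ₀), G (δ w) = w ∧ fderiv ℝ V (δ w) = (Λ w).comp (fderiv ℝ G (δ w))) →
      ∀ᶠ w in 𝓝 (G δ₀), IsMinOn V {δ' | G δ' = w} (δ w)) :
    AnalyticAt ℝ (fun w => ⨅ δ' : {δ' // G δ' = w}, V δ'.1) (G δ₀) := by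
  obtain ⟨δ, Λ, hδ0, hΛ0, hδan, hΛan, hbr, -⟩ := exists_analyticAt_kktBranch hV hG hT hkkt hnd
  have hev : ∀ᶠ w in 𝓝 (G δ₀), (⨅ δ' : {δ' // G δ' = w}, V δ'.1) = V (δ w) := by
    filter_upwards [hbr, hmin δ Λ hδ0 hΛ0 hδan hΛan hbr] with w hw hm
    exact iInf_fibreG_eq_of_isMinOn hw.1 hm
  have hcomp : AnalyticAt ℝ (V ∘ δ) (G δ₀) := by
    have h1 : AnalyticAt ℝ V (δ (G δ₀)) := by rw [hδ0]; exact hV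
    exact analyticAt_comp_kktBranch h1 hδan
  exact hcomp.congr (hev.mono fun w hw => by simpa [Function.comp] using hw.symm)

/-! ## §3. Toy -/

/-- Toy: `E = F = ℝ`, `G = id`, `V` analytic at `x`: every point is its own fibre and the value function is `V`. [folklore] -/
example {V : ℝ → ℝ} {x : ℝ} (hV : AnalyticAt ℝ V x) :
    AnalyticAt ℝ (fun w => ⨅ δ' : {δ' // id δ' = w}, V δ'.1) (id x) := by
  have hG : AnalyticAt ℝ (id : ℝ → ℝ) x := analyticAt_id
  have hfd : fderiv ℝ (id : ℝ → ℝ) x = ContinuousLinearMap.id ℝ ℝ := fderiv_id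
  refine analyticAt_constrValueG_of_kkt (Λ₀ := fderiv ℝ V x) hV hG ?_ ?_ ?_ ?_
  · rw [hfd]; exact fun y => ⟨y, rfl⟩
  · rw [hfd, ContinuousLinearMap.comp_id]
  · intro k hk _
    rw [hfd] at hk
    simpa using hk
  · intro δ _ _ _ _ _ hbr
    filter_upwards [hbr] with w hw
    intro δ' hδ'
    have hw1 : δ w = w := hw.1
    simp only [id_eq, mem_setOf_eq] at hδ'
    rw [hδ', hw1]
    exact le_refl (V w)

end Summit.QuantumFields.BalabanUV.T4Continuum.NE7b.ConstrainedMinimiserAnalyticNonlinear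

end
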